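import Literature.NumberTheory.LFunctions.WeilWindowSimpleEven
import Literature.NumberTheory.LFunctions.WeilExplicitProofs

/-!
# Sketch (transport check) for crux SignConeDuality — ideator k = 1

The item's `let`-bound prime-free Weil form `W F := M_F 0 + M_F 1 + ((1/2π)·∫ M_F(1/2+it)·Re ψ(1/4+it/2) dt − F 0·log π)`
is DEFINITIONALLY `weilPolarTerm F + weilArchTerm F`; hence its additivity on test kernels is the
in-tree `weilMellin_add` + `weilArchIntegral_add` after a `show`. (Cone-hygiene caveat: these
modules import `WeilExplicit`, home of the `@[conjecture] WeilPositivity`; see the card.)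
-/

open Literature.NumberTheory.LFunctions

namespace Summit.RiemannHypothesis.RiemannHypothesis.Cruxes.SignConeDuality.RatioInduction

/-- Moment additivity of the prime-free Weil form on test kernels, by transport to the
Literature vocabulary. PROVED (modulo the two in-tree lemmas it names). -/
theorem archPolar_add' (F₁ F₂ : ℝ → ℂ)
    (h₁ : ContDiff ℝ ((⊤ : ℕ∞) : WithTop ℕ∞) F₁ ∧ HasCompactSupport F₁)
    (h₂ : ContDiff ℝ ((⊤ : ℕ∞) : WithTop ℕ∞) F₂ ∧ HasCompactSupport F₂) :
    let W : (ℝ → ℂ) → ℂ := fun F =>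
      let M : ℂ → ℂ := fun s => ∫ u : ℝ, F u * Complex.exp ((s - 1 / 2) * u)
      M 0 + M 1 + ((1 / (2 * Real.pi) : ℂ) * (∫ t : ℝ, M (1 / 2 + t * Complex.I) *
        ((Complex.digamma (1 / 4 + t / 2 * Complex.I)).re : ℂ)) - F 0 * (Real.log Real.pi : ℂ))
    W (F₁ + F₂) = W F₁ + W F₂ := by
  intro W
  have h₁' : IsWeilTest F₁ := h₁
  have h₂' : IsWeilTest F₂ := h₂
  show weilPolarTerm (F₁ + F₂) + weilArchTerm (F₁ + F₂) =
    (weilPolarTerm F₁ + weilArchTerm F₁) + (weilPolarTerm F₂ + weilArchTerm F₂)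
  simp only [weilPolarTerm, weilArchTerm, weilArchIntegral_add h₁' h₂',
    weilMellin_add h₁'.1.continuous h₁'.2 h₂'.1.continuous h₂'.2, Pi.add_apply]
  ring

/-- The hermitian symmetry used to read `Re (G(log n) + G(−log n)) = 2 Re G(log n)` for
`G = g ⋆ g̃` (in tree: `conj_weilConv_weilReflect_neg`), transported to the item's spelling. -/
theorem autocorr_neg (g : ℝ → ℂ) (t : ℝ) :
    (starRingEnd ℂ) ((MeasureTheory.convolution g (fun u => (starRingEnd ℂ) (g (-u)))
      (ContinuousLinearMap.mul ℂ ℂ) MeasureTheory.MeasureSpace.volume) (-t)) =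
    (MeasureTheory.convolution g (fun u => (starRingEnd ℂ) (g (-u)))
      (ContinuousLinearMap.mul ℂ ℂ) MeasureTheory.MeasureSpace.volume) t := by
  show (starRingEnd ℂ) (weilConv g (weilReflect g) (-t)) = weilConv g (weilReflect g) t
  exact conj_weilConv_weilReflect_neg g t

end Summit.RiemannHypothesis.RiemannHypothesis.Cruxes.SignConeDuality.RatioInduction
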